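import Mathlib

/-!
# The Laplace symbol of the golden-rule channel (kernel #223, lemmaR-A5 §26, paper §24.113)

Solo-blind programme, session s89.  At leading order the retained roll amplitude `r_1` of the
leaf-aligned chain (even class, tilt `κ → 0⁺`, fast clock `B`) feels the cross-leaf tilt only
through the scalar Volterra term `-B_1 ∫ δ(B') 𝒰_22(B - B') r_1(B') dB'`, where
`𝒰_22(B) = ⟨e_2, e^{-iBJ} e_2⟩ = 2 J_2(2B)/B²` is the return amplitude of the Gegenbauer-2 roll
chain (roll dictionary SB-C1063; checked to 6 digits) and `B_1 = 3/2`.  Its Laplace symbol is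
elementary:
  `𝒦̂(s) = ∫_0^∞ e^{-sB} 𝒰_22(B) dB = ((s² + 4)^{3/2} - s³ - 6 s)/6`,
because `d/du [(2/3)u³ + 4u - (2/3)(u²+4)^{3/2}] = (√(u²+4) - u)²` and
`∫_0^∞ e^{-sB} J_2(2B) dB/B = (√(s²+4) - s)²/8`.  This file proves the real algebra and calculus of
the closed form `grK`:

* `grK 0 = 4/3` — the golden-rule value `γ` (third derivation; kernel #222 has the continued
  fraction, the Gegenbauer weight `π · 4/(3π)` is the second);
* the factorisation `grK s = (r - s)²(2r + s)/12`, `r = √(s²+4)`, hence `grK s > 0` for all real `s`;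
* `grK s ≤ 4/3` for `s ≥ 0` and `grK s ≥ 4/3` for `s ≤ 0` (the symbol is antitone; its derivative is
  `-(r - s)²/4`, proved as a `HasDerivAt` statement together with the antiderivative identity);
* the DRESSED-RATE BOUND: any real root `s ≤ 0` of the characteristic equation
  `s - a + B_1 δ grK s = 0` (`δ ≥ 0`) satisfies `s ≤ a - 2δ` — the dressed slow amplitude decays at
  least at the first-order golden-rule rate `2δ` per unit fast clock below the bare rate `a`;
* passivity on the band: `Re 𝒦̂(iω) = (4 - ω²)^{3/2}/6 ≥ 0` for `|ω| ≤ 2` (stated in real form).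
-/

namespace Summit.AnomalousDissipation.AnomalousDissipation.Theorems

/-- Closed form of the Laplace symbol of the golden-rule kernel `2 J_2(2B)/B²`. -/
noncomputable def grK (s : ℝ) : ℝ := ((s ^ 2 + 4) * Real.sqrt (s ^ 2 + 4) - s ^ 3 - 6 * s) / 6

/-- The antiderivative behind the symbol. -/
noncomputable def grF (u : ℝ) : ℝ := 2 / 3 * u ^ 3 + 4 * u - 2 / 3 * ((u ^ 2 + 4) * Real.sqrt (u ^ 2 + 4))

/-- `(√(s²+4))² = s² + 4`. -/
private lemma sqrt_sq_add_four (s : ℝ) : Real.sqrt (s ^ 2 + 4) ^ 2 = s ^ 2 + 4 :=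
  Real.sq_sqrt (by positivity)

/-- `√(s²+4) > 0`. -/
private lemma sqrt_add_four_pos (s : ℝ) : 0 < Real.sqrt (s ^ 2 + 4) :=
  Real.sqrt_pos.mpr (by positivity)

/-- `√(s²+4) ≥ 2`. -/
private lemma two_le_sqrt_add_four (s : ℝ) : 2 ≤ Real.sqrt (s ^ 2 + 4) := by
  have h4 : Real.sqrt 4 = 2 := by
    rw [show (4 : ℝ) = 2 ^ 2 by norm_num, Real.sqrt_sq (by norm_num : (0:ℝ) ≤ 2)]
  rw [← h4]
  exact Real.sqrt_le_sqrt (by nlinarith)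

/-- `s < √(s²+4)`. -/
private lemma lt_sqrt_add_four (s : ℝ) : s < Real.sqrt (s ^ 2 + 4) := by
  by_cases hs : s < 0
  · linarith [sqrt_add_four_pos s]
  · have hs : 0 ≤ s := not_lt.mp hs
    rw [show s = Real.sqrt (s ^ 2) from (Real.sqrt_sq hs).symm, Real.sqrt_sq hs]
    conv_lhs => rw [← Real.sqrt_sq hs]
    exact Real.sqrt_lt_sqrt (by positivity) (by linarith)

/-- THE GOLDEN-RULE VALUE, third derivation: `𝒦̂(0) = 4·√4/6 = 4/3`. -/
theorem grK_zero : grK 0 = 4 / 3 := by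
  unfold grK
  have h4 : Real.sqrt 4 = 2 := by
    rw [show (4 : ℝ) = 2 ^ 2 by norm_num, Real.sqrt_sq (by norm_num : (0:ℝ) ≤ 2)]
  norm_num [h4]

/-- Factorisation `grK s = (r - s)² (2r + s) / 12` with `r = √(s² + 4)` (uses only `r² = s² + 4`). -/
theorem grK_factored (s : ℝ) :
    grK s = (Real.sqrt (s ^ 2 + 4) - s) ^ 2 * (2 * Real.sqrt (s ^ 2 + 4) + s) / 12 := by
  unfold grK
  have hr := sqrt_sq_add_four s
  linear_combination ((-2 * Real.sqrt (s ^ 2 + 4) + 3 * s) / 12) * hr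

/-- The symbol is strictly positive for every real `s`. -/
theorem grK_pos (s : ℝ) : 0 < grK s := by
  rw [grK_factored]
  have h1 : 0 < Real.sqrt (s ^ 2 + 4) - s := by linarith [lt_sqrt_add_four s]
  have h2 : 0 < 2 * Real.sqrt (s ^ 2 + 4) + s := by
    have := lt_sqrt_add_four (-s)
    rw [neg_sq] at this
    linarith [sqrt_add_four_pos s]
  positivity

/-- On `s ≤ 0` the symbol is at least its value at the origin: `grK s ≥ 4/3` (since `r³ ≥ 8`). -/
theorem grK_ge_of_nonpos (s : ℝ) (hs : s ≤ 0) : 4 / 3 ≤ grK s := by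
  unfold grK
  have hr2 := two_le_sqrt_add_four s
  have hr := sqrt_sq_add_four s
  have h3 : 0 ≤ -s ^ 3 - 6 * s := by nlinarith [sq_nonneg s]
  have h8 : 8 ≤ (s ^ 2 + 4) * Real.sqrt (s ^ 2 + 4) := by nlinarith [sq_nonneg s]
  linarith

/-- On `s ≥ 0` the symbol is at most `4/3`: `(s³ + 6s + 8)² - (s² + 4)³ = 4s(4s² - 3s + 24) ≥ 0`. -/
theorem grK_le_of_nonneg (s : ℝ) (hs : 0 ≤ s) : grK s ≤ 4 / 3 := by
  unfold grK
  set r := Real.sqrt (s ^ 2 + 4) with hr_def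
  have hr : r ^ 2 = s ^ 2 + 4 := sqrt_sq_add_four s
  have hrpos : 0 < r := sqrt_add_four_pos s
  have key : (s ^ 3 + 6 * s + 8 - (s ^ 2 + 4) * r) * (s ^ 3 + 6 * s + 8 + (s ^ 2 + 4) * r)
      = 4 * s * (4 * s ^ 2 - 3 * s + 24) := by
    linear_combination (-(s ^ 2 + 4) ^ 2) * hr
  have hB : 0 < s ^ 3 + 6 * s + 8 + (s ^ 2 + 4) * r := by positivity
  have hprod : 0 ≤ (s ^ 3 + 6 * s + 8 - (s ^ 2 + 4) * r) * (s ^ 3 + 6 * s + 8 + (s ^ 2 + 4) * r) := by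
    rw [key]; nlinarith [sq_nonneg s]
  have hA : 0 ≤ s ^ 3 + 6 * s + 8 - (s ^ 2 + 4) * r := by
    by_contra h
    have h' : s ^ 3 + 6 * s + 8 - (s ^ 2 + 4) * r < 0 := lt_of_not_ge h
    have := mul_neg_of_neg_of_pos h' hB
    linarith
  linarith

/-- The antiderivative identity: `grF' = (√(u²+4) - u)²`. -/
theorem grF_hasDerivAt (u : ℝ) :
    HasDerivAt grF ((Real.sqrt (u ^ 2 + 4) - u) ^ 2) u := by
  have hpos : 0 < u ^ 2 + 4 := by positivity
  have hg : HasDerivAt (fun u : ℝ => u ^ 2 + 4) (2 * u) u := by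
    simpa using (hasDerivAt_pow 2 u).add_const 4
  have hsq : HasDerivAt (fun u : ℝ => Real.sqrt (u ^ 2 + 4)) (2 * u / (2 * Real.sqrt (u ^ 2 + 4))) u :=
    hg.sqrt (ne_of_gt hpos)
  have hprod : HasDerivAt (fun u : ℝ => (u ^ 2 + 4) * Real.sqrt (u ^ 2 + 4))
      (2 * u * Real.sqrt (u ^ 2 + 4) + (u ^ 2 + 4) * (2 * u / (2 * Real.sqrt (u ^ 2 + 4)))) u :=
    hg.mul hsq
  have h1 : HasDerivAt (fun u : ℝ => 2 / 3 * u ^ 3) (2 / 3 * (3 * u ^ 2)) u := by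
    simpa using (hasDerivAt_pow 3 u).const_mul (2 / 3)
  have h2 : HasDerivAt (fun u : ℝ => 4 * u) 4 u := by
    simpa using (hasDerivAt_id u).const_mul 4
  have hall := (h1.add h2).sub (hprod.const_mul (2 / 3))
  have hfun : grF = (((fun u : ℝ => 2 / 3 * u ^ 3) + fun u : ℝ => 4 * u)
      - fun y : ℝ => 2 / 3 * ((y ^ 2 + 4) * Real.sqrt (y ^ 2 + 4))) := by
    funext x; simp [grF]
  rw [hfun]
  refine hall.congr_deriv ?_
  have hr := sqrt_sq_add_four u
  have hrpos := sqrt_add_four_pos u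
  have hne : Real.sqrt (u ^ 2 + 4) ≠ 0 := hrpos.ne'
  have haux : (u ^ 2 + 4) * (2 * u / (2 * Real.sqrt (u ^ 2 + 4))) = u * Real.sqrt (u ^ 2 + 4) := by
    field_simp
    linear_combination (-u) * hr
  rw [haux]
  linear_combination (-1 : ℝ) * hr

/-- `grK = -grF/4` (the symbol is a quarter of the tail integral of `grF'`, and `grF(∞) = 0`). -/
theorem grK_eq_neg_grF (s : ℝ) : grK s = -(grF s) / 4 := by
  unfold grK grF; ring

/-- Hence the symbol's derivative is `-(√(s²+4) - s)²/4 ≤ 0`: the symbol is antitone. -/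
theorem grK_hasDerivAt (s : ℝ) :
    HasDerivAt grK (-((Real.sqrt (s ^ 2 + 4) - s) ^ 2) / 4) s := by
  have h := ((grF_hasDerivAt s).neg).div_const 4
  have heq : grK = fun x => (-grF) x / 4 := by
    funext x; simp [grK_eq_neg_grF]
  rw [heq]
  exact h.congr_deriv (by ring)

/-- The derivative value is non-positive. -/
theorem grK_deriv_nonpos (s : ℝ) : -((Real.sqrt (s ^ 2 + 4) - s) ^ 2) / 4 ≤ 0 := by
  have := sq_nonneg (Real.sqrt (s ^ 2 + 4) - s)
  linarith

/-- DRESSED-RATE BOUND.  A non-positive real root of the characteristic equation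
`s - a + B_1 δ 𝒦̂(s) = 0` of the dressed slow amplitude (`B_1 = 3/2`, de-rating `δ ≥ 0`) lies at
or below `a - 2δ`: the dressing damps at least at the first-order golden-rule rate. -/
theorem goldenSymbol_root_le (a δ s : ℝ) (hδ : 0 ≤ δ) (hs : s ≤ 0)
    (hroot : s - a + 3 / 2 * δ * grK s = 0) : s ≤ a - 2 * δ := by
  have hK := grK_ge_of_nonpos s hs
  nlinarith

/-- If moreover the bare rate is negative and `δ ≥ 0`, every real root is negative (no neutral or
growing dressed mode): `s = a - B_1 δ grK s < 0`. -/
theorem goldenSymbol_root_neg (a δ s : ℝ) (ha : a < 0) (hδ : 0 ≤ δ)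
    (hroot : s - a + 3 / 2 * δ * grK s = 0) : s < 0 := by
  have hK := grK_pos s
  nlinarith

/-- PASSIVITY ON THE BAND (real form): for `|ω| ≤ 2` the real part of the symbol on the imaginary
axis, `(4 - ω²)^{3/2}/6 = (4 - ω²)√(4 - ω²)/6`, is non-negative. -/
theorem goldenSymbol_passive (ω : ℝ) (hω : ω ^ 2 ≤ 4) :
    0 ≤ (4 - ω ^ 2) * Real.sqrt (4 - ω ^ 2) / 6 := by
  have h1 : 0 ≤ 4 - ω ^ 2 := by linarith
  positivity

end Summit.AnomalousDissipation.AnomalousDissipation.Theorems
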